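import Summits.HodgeConjecture.HodgeConjecture.Theorems.F0P6aStubRHO1
import HarnessLib
import HarnessLib.Audit.LibrarySuggestionsDenyListCruxes

/-!
# F0_P6a_StubRHO1 — ED. 2 = SHIM (K6 L2 column re-home; pen LA2-plan (g5) PLAN «L2 cone RE-HOME» v1.4 + RULING R5 (d1) 00:47Z 09-03; ★ parts = the PRE-CURED (d1) set v3d1 by LA2-p02 (g5) (`F0/P6/L2/LA2-p02/g5/k6v3d1/StubRHO1/`), filer LA2-p04 (g6) (alt LA2-p01 (g6)); box LAref-D first ∕ LA-ref1 second; template LA2-p03 (g7) v1tmpl 8fd2286e, docstring re-trued for v3d1 by the pen (v2tmpl))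

Twenty-six of the twenty-eight declarations of the tree workfile `Lines/F0_P6a_StubRHO1.lean` ((ρ1𝒞) leaflet v6, first tree edition, sha16 ce86702e556aed39, 1596 l., sorry-free, stub-free; 28 theorems)
now live, statement for statement and under the SAME namespace `Summit.HodgeConjecture.HodgeConjecture.Cruxes.HLiu418.F0P6aLineSpecialisation`, in the ★ chain
★ `Theorems/F0P6aStubRHO1K4Seam.lean` (p853466) → ★ `Theorems/F0P6aStubRHO1KillRow.lean` (p853498) → ★ `Theorems/F0P6aStubRHO1DockFold.lean` (p853516) → ★ `Theorems/F0P6aStubRHO1Rho1Rows.lean` (p853526) → ★ `Theorems/F0P6aStubRHO1Rho1Dock.lean` (p853538) → ★ `Theorems/F0P6aStubRHO1.lean` (p853548) (LAST part = plain stem; each part imports the previous):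
`hr4_of_kerRow`, `comp_comp_eq_one_of_intertwine`, `hqι_of_kerRow`, `hkerq_of_kerRow`, `hfin_of_kerRow`, `hrkK_of_kerRow`, `k2_row_of_kerRow`, `rk_row_of_kerRow`, `kill_row_of_kerRow_sigma`, `dockSeal₁`, `dockSeal₂`, `dockSeal₃`,
`dock_row_of_kerRow`, `dock_row_of_kerRow_unseal`, `dock_row_of_legs_sigma`, `exists_roofLeg_kerRowsFin_image_of_dlineLegs`, `sigma_pins`, `rho1_rowsMFALS_of_leg`, `rho1_rowK2_of_leg`, `rho1_rowsA_of_leg`, `rho1_rowRK_of_leg`,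
`rho1_rowKILL_of_leg`, `rho1_rowDOCK_of_leg`, `rho1_rowIMG_of_leg`, `exists_quotLegReduction_of_legs`, last head `exists_quotLegReduction` (= the (ρ1𝒞) head the leaf՚s `stub_RHO1` letter aliases; order preserved).
The other TWO — by-copy restatements of ★ theorems, tree :164 `act₀Of_hom_hom_hom_eq'` (≡ ★ `…Cruxes.HLiu418.F0P6aRoofCwKernel.act₀Of_hom_hom_hom`, `Theorems/F0P6aRoofCwKernelKernelReadingRank.lean` :125, a `rfl` law with 0 call sites)
and tree :706 `roofΩ_legs_isFinite_surjective` (≡ ★ `…Cruxes.HLiu418.F0P6aStubFROBRoofLegs.roofΩ_legs_isFinite_surjective`, `Theorems/F0P6aStubFROBRoofLegsKernelRows.lean` :82) — were DELETED in the ★ twin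
under the LEAD՚s «M-142e» class (d1) «dedup.landed» cure (LA2-p03 (g7) CONE-DEDUP-CENSUS 9936b54d TABLE A) and resolve at those ★ homes, both in this module՚s import closure through ★ part 1.
No tree file reads the two deleted names through this module (`rg -w` over `Cruxes/HLiu418/Lines` + `Theorems`, 02:05Z 09-03: `SpecOrgansU` uses its own primed `roofΩ_legs_isFinite_surjective'`; the unprimed
name is read only inside ★ `F0P6aStubFROBRoofLegsKernelRows` itself) ⇒ CLOSURE-NAMES contribution of the (d1) cure = ∅ and nothing to alias; this module keeps its name so that its tree importers
(`Lines/F0_P6a_StubFROB.lean`, `Lines/F0_P6a_StubDOWN.lean`) and any by-name reader under `open …F0P6aLineSpecialisation` resolve the twenty-six unchanged through the import above.  It declares nothing.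
ORDER NOTE: written under the standing wave rule («M-150») after EVERY ★ part above is ACCEPTED and served (NO-CROSS-IMPORT: no environment may hold a `Lines/` ORIGINAL of this column together with its ★ twin);
an importer smoke that reads «environment already contains …» before the wave՚s request is BUILT is this order note, not a defect.  Edition history stays in the line card
`Lines/F0_P6a_StubRHO1.md` and in git; future changes are ★-side proposals on the `Theorems/` files.
HC_CM is proved only modulo the 7 printed citations (2 remaining named inputs: hLiu418 = stmt-HodgeConjecture-24832, h413 = stmt-HodgeConjecture-24833) until rung 0 closes; count-neutral (0 `sorry`, 0 socket, 0 declarations). -/
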